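import Literature.NumberTheory.Automorphic.Liu2021.AppendixC.DefC1toC3
import Literature.NumberTheory.Automorphic.Liu2021.AppendixC.Glue
import Literature.AlgebraicGeometry.AbelianSchemes.AbelianSchemeOverRingAction
import Literature.AlgebraicGeometry.AbelianSchemes.AbelianSchemeFibreHom
import Literature.AlgebraicGeometry.AbelianSchemes.AbelianSchemeDualIsogeny
import Literature.AlgebraicGeometry.Motives.AbelianVarietyCotangent
import Literature.AlgebraicGeometry.Motives.AlgPoints
import Mathlib.RingTheory.DedekindDomain.FiniteAdeleRing
import Mathlib.RingTheory.TensorProduct.Free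
import Mathlib.LinearAlgebra.Matrix.SesquilinearForm
import Mathlib.AlgebraicGeometry.Noetherian
import HarnessLib

/-!
# Liu 2021, Appendix C §C.2 «Case of similitude»: Definition C.10, Definition C.11, Definition C.12 (with the
# decomposition `M(𝕎^∞,Ψ)_L ≃ ∐_W Sh(H, h_{W,Ψ})_L`), Remark C.13 — AS PRINTED (statement typing; no proof of any result)
# + the §C.1 residue Remark C.9 and an INDEX of §C.1 (C.1–C.9) into the tree

[Liu2021] = Yifeng Liu, *Fourier–Jacobi cycles and arithmetic relative trace formula* (with an appendix by Chao Li and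
Yihang Zhu), Cambridge J. Math. **9** (2021), no. 1, 1–147 = arXiv:2102.11518.  SOURCES READ FOR THIS FILE (two, cross-checked
sentence by sentence, no difference in wording or numbering for §C.2): (1) the PRINT, lit key
`paper:liu2021-fourier-jacobi-cycles-arithmetic-relative-trace-formula`, page files p0109–p0112 (= journal pp. 109–112; cited
«(p. N)»); (2) the author's TeX of the arXiv e-print `FJcycle.tex` (md5 `6db49a74122d2cb0f224fa1b39488a0c`; cited «l. NNNN»),
§C.2 = `\subsection{Case of similitude}` (label `ss:appendix_similitude`) l. 4674–4771, print p. 110 L27 – p. 112 L34.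
NUMBERING (one counter per appendix, cf. `DefC1toC3`): **Def. C.10** = `de:abelian_data` l. 4685–4695 (p. 110) · **Def. C.11** =
l. 4697–4703 (pp. 110–111) · **Def. C.12** = `de:moduli_similitude` «([Kot92])» l. 4741–4751 (pp. 111–112) · **Rem. C.13** =
`re:integral_similitude` l. 4761–4771 (p. 112); unnumbered: the set `𝒲(𝕎^∞,Ψ)` and «It is a finite set; and its cardinality is at
most one if `n` is even» (l. 4705–4711, p. 111 L18–26), the group of similitude `H`, the Hodge map `h_{W,Ψ}` and the Shimura
varieties `Sh(H, h_{W,Ψ})_L` (l. 4713–4737, p. 111 L27–61), the decomposition «From [Kot92] …» (l. 4753–4757, p. 112 L10–19).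
Cell `hodgecm-mathlib`, carpet squad TL «Liu FJ∕418», typer TL-t04 (deal TL-plan 2026-09-02T01:55:56Z); file-path namespace
`Literature.NumberTheory.Automorphic.Liu2021.AppendixC.SecC2Similitude`.  HC_CM is proved only modulo the 7 printed citations
(2 remaining: hLiu418 = stmt-HodgeConjecture-24832, h413 = stmt-HodgeConjecture-24833) until rung 0 closes; this file
discharges none of them and asserts nothing.

## Discipline (squad ruling TL-plan 01:59:30Z; precedents `PropC5Data` ∕ `ShimuraSystemFlat` ∕ `Thm418Data` of this directory)

DEFINITIONS of print are REAL `def`∕`structure`s over Mathlib ∕ tree notions wherever Mathlib ∕ the tree has the objects;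
objects Lean cannot construct (canonical models of Shimura varieties, Kottwitz's «`L`-level structure» — print itself only
points to [Kot92, §5] —, the restricted-product topology of `𝐇^∞(𝔸^∞)`, «neat», the pull-back functoriality of the moduli
presheaves) are **⟨CARRIER⟩** fields of ONE hypothesis structure `SecC2Data`, each quoting the printed definition; every
printed CLAIM is a predicate `def … (D : SecC2Data …) : Prop` (or a closed `Prop` on REAL data).  NOTHING IS ASSERTED: no
declaration has a printed claim as its type; a consumer takes `(h : <Claim> D)` for ITS OWN datum.  No `sorry`, no `axiom`, no
`instance`, no notation, no attribute manipulation; no theorem (statement typing only).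

## READINGS (the only interpretive choices; none adds or removes a printed hypothesis)

* **R1 (coordinates, as `DefC1toC3` R4).** «a free `E ⊗_ℚ R`-module `W` of rank `n`» (Def. C.11) is typed IN COORDINATES as
  `W = (E ⊗_ℚ R)^{⊕ n}` = `Fin n → ER E R`, with `ER E R := R ⊗[ℚ] E` (Mathlib's `R`-algebra structure sits on the left
  factor; `E ⊗_ℚ R ≅ R ⊗_ℚ E` canonically).  Similarity classes (`IsSimilar`, the set `𝒲(𝕎^∞,Ψ)`) do not see the coordinates;
  `GL_{E⊗_ℚ R}(W)` = `GL (Fin n) (ER E R)`, as print identifies `H_ℝ(ℝ) ⊆ GL_n(ℂ)^d × ℂ^×` (l. 4737).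
* **R2 (`p_τ`, `q_τ` from `Ψ`).** §C.2 keeps the CM type `Φ` of §C.1 (l. 4558 «We take a CM type `Φ ⊆ Φ_E`»; `τ^−`∕`τ^+` = the
  element of `Φ`∕`Φ^c` above `τ`, l. 4563): for `Ψ = Σ_τ p_τ τ^+ + Σ_τ q_τ τ^−` (l. 4681), `p_τ = Ψ(τ^+)`, `q_τ = Ψ(τ^−)`
  (`pOf`, `qOf`, on the tree's `CMType.aboveConj` ∕ `CMType.above`).
* **R3 (the Kottwitz polynomial).** «`∏_{τ∈Φ_F} (T − τ^+(e))^{p_τ} (T − τ^−(e))^{q_τ}`» (l. 4690) `= ∏_{φ ∈ Φ_E} (T − φ(e))^{Ψ(φ)}`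
  (`Φ_E = ⨆_τ {τ^+, τ^−}`) — `kottwitzPoly`; «`∈ 𝒪_S[T]`» for an `E_Ψ`-scheme `S` presupposes that this polynomial has
  coefficients in `E_Ψ` (it is `Stab(Ψ)`-invariant) and is pushed forward along `E_Ψ → Γ(S, 𝒪_S)`: `kottwitzPolyReflex` is THAT
  element of `E_Ψ[T]`, selected by `Classical.epsilon` on the printed property (junk `0`-free: the property determines it).
* **R4 (`i : E → End_S(A)_ℚ`).** The tree's abelian schemes carry ring actions by GENUINE endomorphisms, ring-structure-free
  (★ `AbelianSchemeOver.RingAction`, the carrier cited for Def. C.10 (1) in ★ `AbelianSchemeOverRingAction`); `End_S(A)` is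
  torsion-free, so a `ℚ`-algebra homomorphism `i : E → End_S(A) ⊗ ℚ` is THE SAME DATUM as a ring homomorphism `i|_O : O → End_S(A)`
  on an order `O ⊆ E` (`O := i⁻¹(End_S(A))`; conversely extend `ℚ`-linearly), up to shrinking `O`.  `EPsiAbelianScheme` presents
  `i` by such a restriction (`O`, `isOrder`, `act`), with `O` stable under `c` (always achievable: `O ∩ O^c`), so that Def. C.10
  (2)'s `i(e^c)` is available; all printed conditions are imposed for `e ∈ O` (equivalent to `e ∈ E` by `ℚ`-linearity).
* **R5 (the determinant condition at geometric points).** Print's condition is an identity of characteristic polynomials of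
  `i(e)` on the locally free sheaf `Lie_S(A)` in `𝒪_S[T]`.  Over an `E_Ψ`-scheme `S` (characteristic `0`, `E/ℚ` étale) the
  `E ⊗_ℚ 𝒪_S`-module `Lie_S(A)` splits étale-locally on `S` into eigen-sub-bundles of locally constant rank, so the identity holds
  in `𝒪_S[T]` iff it holds at every geometric point `Spec Ω → S`; `EPsiAbelianScheme.kottwitz` is the latter, in the tree's
  currency `charpoly (cotangentMap (A_s) (i(e)_s))` (cotangent space at the origin = dual of `Lie`, same characteristic
  polynomial; ★ `Motives.AbelianVariety.cotangentMap`, ★ `AbelianSchemeOver.fibre`∕`fibreHom`, the shape of ★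
  `KottwitzCharpolyTransport` ∕ the HLiu418 line `KottwitzΩ`).  For Rem. C.13 (base `O_{E_Ψ,(p)}`, mixed characteristic) this
  equivalence FAILS on non-reduced bases; there the moduli presheaf is a ⟨CARRIER⟩ and the printed sentence is quoted (see `RemC13`).
* **R6 (isogeny over `S`).** «an isogeny `φ : A → A'`» of abelian schemes over `S` = a homomorphism that is an isogeny on every
  geometric fibre (tree `Motives.AbelianVariety.IsIsogeny` on ★ `fibreHom`); for abelian schemes (flat, of finite presentation)
  this is the usual «finite flat surjective homomorphism» by the fibrewise criteria.  «taking `λ` to `cλ'` for some `c ∈ ℚ^×`»: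
  `φ^∨ ∘ λ' ∘ φ = c·λ` in `Hom_S(A, A^∨) ⊗ ℚ`, i.e. `(φ^∨ λ' φ)^b = λ^a` for integers `a, b ≠ 0` (`c = a/b`) in the group
  `Hom_S(A, Â)` (Mathlib's scoped `Hom.group`; ★ `DualPair.dualIsogenyOver` is `φ^∨`).
* **R7 (signature of `⟨ , i·⟩_W` on `W ⊗_{E,τ^−} ℂ`).** For `W` over `E` (`R = ℚ`) let `⟨x, y⟩^† ∈ E` be the unique element
  with `Tr_{E/ℚ}(e·⟨x,y⟩^†) = ⟨ex, y⟩` for all `e ∈ E` (the construction print uses at l. 4787, §C.3; it exists as `Tr_{E/ℚ}` is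
  non-degenerate): an `E`-valued skew-hermitian form with `⟨ , ⟩_W = Tr_{E/ℚ} ∘ ⟨ , ⟩^†`.  On `W ⊗_{E,τ^−} ℂ` the real symmetric
  form `⟨x, i·y⟩` restricted to `E`-rational vectors is `x ↦ 2·Im τ^−(⟨x, x⟩^†)`, so «signature `(p_τ, q_τ)`» = (max `E`-dimension
  of an `E`-subspace on which `Im τ^−(⟨x,x⟩^†) > 0` resp. `< 0` for `x ≠ 0`) — the device of `DefC1toC3` R5 (`posIndex`);
  `E`-rational positive subspaces span `ℂ`-positive ones because `†|_U` is defined over `E` (its radical is `E`-rational).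
  `dagger` is selected by `Classical.epsilon` on its defining property.
* **R8 («neat open compact», «sufficiently small», as `DefC1toC3` R8 ∕ `PropC5` R2).** Mathlib has no topology on
  `GL_n(E ⊗_ℚ 𝔸^∞)`; «neat open compact subgroup `L` of `𝐇^∞(𝔸^∞)`» is ONE ⟨CARRIER⟩ predicate `IsLevel` on subgroups of the
  REAL group `𝐇^∞(𝔸^∞) = similitudes of 𝕎^∞` (`similitudeSubgroup`); «`L` sufficiently small» = «every admissible `L ≤ L₀`» for
  some admissible threshold `L₀`.
* **R9 (`Sch'`).** «presheaf on `Sch'_{/E_Ψ}`» — `Sch'_{/S}` = locally Noetherian schemes over `S` (§1.7, l. 1141, p. 20):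
  the full subcategory `SchLN k` of the tree's `SchemeOver k` on `IsLocallyNoetherian` objects.

## The printed text of §C.2 (verbatim, TeX macros resolved; `𝕎`=`\bW`, `𝐇`=`\bH`, `𝔸`=`\bA`, `c`=`\tc`)

l. 4677 (p. 110 L28–31): «In this subsection, we recall the notion of Shimura varieties attached to the group of similitude of a
hermitian space, which are of PEL type. They will not be used in the main part of the article, but it is instructional to
introduce them for the later discussion.»  l. 4679–4683 (p. 110 L32–37): «Let `Ψ = Σ_{τ∈Φ_F} p_τ τ^+ + Σ_{τ∈Φ_F} q_τ τ^−` be an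
element of `ℕ[Φ_E]` such that `p_τ + q_τ = n` for every `τ ∈ Φ_F`. Let `E_Ψ` be the fixed field of the stabilizer of `Ψ` in
`Gal(ℂ/ℚ)`.»  **Definition C.10** (p. 110 L42–51): «Let `S` be an `E_Ψ`-scheme. (1) An *`(E,Ψ)`-abelian scheme* over `S` is a pair
`(A, i)`, where `A` is an abelian scheme over `S`, and `i : E → End_S(A)_ℚ` is a homomorphism of `ℚ`-algebras such that for every
`e ∈ E`, the characteristic polynomial of `i(e)` on the locally free sheaf `Lie_S(A)` on `S` is equal to
`∏_{τ∈Φ_F} (T − τ^+(e))^{p_τ} (T − τ^−(e))^{q_τ} ∈ 𝒪_S[T]`. (2) A polarization of an `(E,Ψ)`-abelian scheme `(A, i)` is a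
polarization `λ : A → A^∨` satisfying `λ ∘ i(e) = i(e^c)^∨ ∘ λ` for every `e ∈ E`.»  **Definition C.11** (p. 110 L52 – p. 111 L6):
«For a ring `R` containing `ℚ`, a *rational skew-hermitian space* over `E ⊗_ℚ R` of rank `n` is a free `E ⊗_ℚ R`-module `W` of rank
`n` together with a `R`-bilinear skew-symmetric non-degenerate pairing `⟨ , ⟩_W : W × W → R` satisfying `⟨ex, y⟩_W = ⟨x, e^c y⟩_W`
for every `e ∈ E` and `x, y ∈ W`. We say that two rational skew-hermitian spaces `W` and `W'` over `E ⊗_ℚ R` is *similar* if there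
exists an isomorphism `f : W → W'` of `E ⊗_ℚ R`-modules such that there exists some `ν(f) ∈ R^×` satisfying
`⟨f(x), f(y)⟩_{W'} = ν(f)⟨x, y⟩_W` for every `x, y ∈ W`.»  l. 4705–4711 (p. 111 L7–26): «We take a rational skew-hermitian space
`𝕎^∞` over `𝔸_E^∞ = E ⊗_ℚ 𝔸^∞` of rank `n`. Let `𝐇^∞` be the group of similitude of `𝕎^∞`, which is a reductive group over `𝔸^∞`.
We denote by `𝒲(𝕎^∞, Ψ)` the set of similarity classes of rational skew-hermitian spaces `W` over `E` of rank `n` such that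
• `W ⊗_E 𝔸_E^∞` is similar to `𝕎^∞` as a rational skew-hermitian space over `𝔸_E^∞ = E ⊗_ℚ 𝔸^∞` (and we fix a similarity
isomorphism), • the signature of the hermitian form `⟨ , i·⟩_W` on the `ℂ`-vector space `W ⊗_{E,τ^−} ℂ` is `(p_τ, q_τ)`. It is a
finite set; and its cardinality is at most one if `n` is even.»  l. 4713–4737 (p. 111 L27–61): «For every `W ∈ 𝒲(𝕎^∞, Ψ)`, let `H`
be its group of similitude, that is, the reductive group over `ℚ` such that for every ring `R` containing `ℚ`, we have
`H(R) = {h ∈ GL_{E⊗_ℚR}(W ⊗_ℚ R) | ⟨hx, hy⟩_W = ν(h)⟨x, y⟩_W for some ν(h) ∈ R^×}`. We define the Hodge map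
`h_{W,Ψ} : Res_{ℂ/ℝ} 𝔾_m → H_ℝ` to be the one sending `z ∈ ℂ^× = (Res_{ℂ/ℝ}𝔾_m)(ℝ)` to
`(diag(\bar z I_{p_{τ_1}}, z I_{q_{τ_1}}), …, diag(\bar z I_{p_{τ_d}}, z I_{q_{τ_d}}); z \bar z) ∈ H_ℝ(ℝ)`, where we identify `H_ℝ(ℝ)`
as a subgroup of `GL_n(ℂ)^d × ℂ^×` via `{τ_1^−, …, τ_d^−}`. Then we have a Shimura data `(H, h_{W,Ψ})` with the reflex field `E_Ψ`. We
obtain a projective system of schemes `{Sh(H, h_{W,Ψ})_L}_L`, quasi-projective and smooth over `E_Ψ` of dimension `Σ_{τ∈Φ_F} p_τ q_τ`,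
indexed by neat open compact subgroups `L` of `𝐇^∞(𝔸^∞) ≃ H(𝔸^∞)`. The Shimura data `(H, h_{W,Ψ})` is of PEL type. In particular,
it has a moduli interpretation which we roughly recall in the following definition.»  **Definition C.12 ([Kot92])** (p. 111 L64 –
p. 112 L9): «For an open compact subgroup `L ⊆ 𝐇^∞(𝔸^∞)`, we define a presheaf `M(𝕎^∞, Ψ)_L` on `Sch'_{/E_Ψ}` as follows: For
every object `S ∈ Sch'_{/E_Ψ}`, we let `M(𝕎^∞, Ψ)_L(S)` be the set of equivalence classes of quadruples `(A, i, λ, η)`, where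
• `(A, i)` is an `(E,Ψ)`-abelian scheme over `S` (Definition C.10), • `λ` is a polarization of `(A, i)` (Definition C.10), • `η` is
an `L`-level structure (see [Kot92, Section 5] for more details). Two quadruples `(A, i, λ, η)` and `(A', i', λ', η')` are
equivalent if there is an isogeny `φ : A → A'` taking `i, λ, η` to `i', cλ', η'` for some `c ∈ ℚ^×`.»  l. 4753–4757 (p. 112
L10–19): «From [Kot92], it is known that `M(𝕎^∞, Ψ)_L` is a scheme if `L` is sufficiently small, and we have a canonical isomorphism
`M(𝕎^∞, Ψ)_L ≃ ∐_{W ∈ 𝒲(𝕎^∞,Ψ)} Sh(H, h_{W,Ψ})_L` functorial in `L`.»  **Remark C.13** (p. 112 L20–34): «Let `p` be a rational prime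
unramified in `E` such that we may write `L = L^p × L_p` in which `L_p` is the stabilizer of a self-dual lattice in
`𝕎^∞ ⊗_{𝔸^∞} ℚ_p`. Then the presheaf `M(𝕎^∞, Ψ)_L` admits an extension `𝓜(𝕎^∞, Ψ)_L` to a presheaf on `Sch'_{/O_{E_Ψ,(p)}}` as
follows: For every object `S ∈ Sch'_{/O_{E_Ψ,(p)}}`, we let `𝓜(𝕎^∞, Ψ)_L(S)` be the set of equivalence classes of quadruples
`(A, i, λ, η^p)`, where • `(A, i)` is an `(E,Ψ)`-abelian scheme over `S` in the sense similar to Definition C.10 but with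
`i : O_{E,(p)} → End_S(A) ⊗_ℤ ℤ_{(p)}` being a homomorphism of `ℤ_{(p)}`-algebras, • `λ` is a `p`-principal polarization of `(A, i)`,
• `η^p` is an `L^p`-level structure. The equivalence relation is defined in a similar way as in Definition C.12 except that we
require the isogenies to be coprime to `p` and `c ∈ ℤ_{(p)}^×`. The functor `𝓜(𝕎^∞, Ψ)_L` is a smooth separated scheme in
`Sch_{/O_{E_Ψ,(p)}}` if `L` is sufficiently small; and is functorial in `L`.»

## INDEX of §C.1 (C.1–C.9, pp. 107–110) into the tree (cited by name, not restated; deal TL-plan 01:55:56Z)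

Def. C.1 + (C.1) + the §C.1 standing data ↦ ★ `AppendixC/DefC1toC3.lean` (`HermSpace`, `sigElt`, `sigFlatElt`, `reflexField`,
`reducedReflexField`, `unitaryGroup`, `Gfin`, `hodgeMapFlat`, ⟨CARRIER⟩ `ShimuraSystemFlat`); Rem. C.2 ↦ `HermSpace.IsSignatureN1At`,
`hodgeMap`, ⟨CARRIER⟩ `ShimuraSystem` (ibid.); Def. C.3 ↦ `IncoherentHermSpace`, `IsTotallyPositiveDefinite` (ibid.); Def. C.4 ↦ ★
`AppendixC/DefC4.lean` (`IsNearby`, `IsNearbySpace`); Prop. C.5 ↦ ★ `AppendixC/PropC5.lean` (`PropC5Data`, `PropC5AsPrinted`);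
Def. C.6 ↦ ★ `AppendixC/Glue.lean` `IncoherentShimuraSystem` (+ `propC5AsPrinted_iff`); l. 4656 + Def. C.8 ↦ `Glue.lean`
`CompactifiedSystem`; **Rem. C.9** («The boundary `S̃h(𝕍)_K ∖ Sh(𝕍)_K` is a smooth divisor», l. 4667–4669, p. 110 L25) had no
declaration: typed HERE as `RemC9` on `CompactifiedSystem`.  NOT TYPED anywhere (recorded): Rem. C.7 (l. 4644–4654, p. 109 L30 –
p. 110 L2: «One can also interpret Proposition C.5 in the following way: The scheme `∏_{τ∈Φ_F} ∏_{τ'∈π^{−1}τ} Sh(G(τ), h_{V(τ),τ'})_K`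
over `∏_{τ∈Φ_F} ∏_{τ'∈π^{−1}τ} Spec τ'(E) = ∏_{τ'∈Φ_E} Spec τ'(E)` descends to a scheme `Sh(𝕍)_K` over `Spec E`, where the above
fiber products are taken over `Spec ℚ`.» — an informal reformulation of Prop. C.5 whose descent datum is not printed) and the
display (C.2) `S̃h(𝕍)_K ⊗_{E,τ^±} τ^±(E) ≃ S̃h(G, h_{V,τ^±})_K` (l. 4657–4660, case `d = 1`; needs the toroidal compactification of
`Sh(G, h_{V,τ^±})_K` [AMRT], [Pin90] as a further carrier; no consumer).

## References
* [Liu2021] Y. Liu, Camb. J. Math. 9 (2021) 1–147, arXiv:2102.11518 — App. C §C.2, l. 4674–4771 (pp. 110–112); §C.1 Rem. C.7,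
  Rem. C.9 (pp. 109–110); §1.7 l. 1141 (p. 20) for `Sch'`.
* [Kottwitz1992] R. E. Kottwitz, *Points on some Shimura varieties over finite fields*, J. Amer. Math. Soc. 5 (1992), §5
  (pp. 389–392) — the moduli problem Liu cites as «[Kot92]» (not re-read for this file; quoted through Liu).
* Tree: ★ `AppendixC/DefC1toC3`, `DefC4`, `PropC5`, `Glue` (§C.1); ★ `AlgebraicGeometry/AbelianSchemes/AbelianSchemeOverBase`
  (`AbelianSchemeOver`, `fibre`), `AbelianSchemeOverRingAction` (`RingAction`, cites Def. C.10 (1)), `AbelianSchemeDualPair` ∕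
  `AbelianSchemePolarization` (`DualPair`, `Polarization`), `AbelianSchemeDualIsogeny` (`dualIsogenyOver`), `AbelianSchemeFibreHom`
  (`fibreHom`); ★ `Motives/AbelianVarietyCotangent` (`cotangentMap`), `Motives/AbelianVariety` (`IsIsogeny`), `Motives/AlgPoints`.
-/

noncomputable section

open CategoryTheory AlgebraicGeometry NumberField Polynomial IsDedekindDomain
open scoped TensorProduct Matrix MatrixGroups MonObj
open Literature.AlgebraicGeometry.Motives (CMType SchemeOver AlgPoints IsProjectiveOver)
open Literature.AlgebraicGeometry.AbelianSchemes (AbelianSchemeOver)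
open Literature.NumberTheory.Automorphic.Liu2021.AppendixC

namespace Literature.NumberTheory.Automorphic.Liu2021.AppendixC.SecC2Similitude

variable (F E : Type) [Field F] [NumberField F] [IsTotallyReal F] [Field E] [NumberField E] [Algebra F E]
  [IsTotallyComplex E] [Algebra.IsQuadraticExtension F E]

/-! ## §C.2 set-up (l. 4679–4683, p. 110 L32–37): `Ψ`, `p_τ`, `q_τ`, `E_Ψ` -/

/-- **`p_τ`** — the coefficient of `Ψ ∈ ℕ[Φ_E]` at `τ^+` (the element of `Φ^c` above `τ ∈ Φ_F`, l. 4563; tree `CMType.aboveConj`),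
for «`Ψ = Σ_{τ∈Φ_F} p_τ τ^+ + Σ_{τ∈Φ_F} q_τ τ^−`» (l. 4681; READING R2). [cite: Liu2021, App. C §C.2 l. 4679–4683 (p. 110)] -/
def pOf (Φ : CMType E) (Ψ : (E →+* ℂ) →₀ ℕ) (τ : F →+* ℝ) : ℕ :=
  Ψ (CMType.aboveConj F E Φ τ)

/-- **`q_τ`** — the coefficient of `Ψ` at `τ^−` (the element of `Φ` above `τ`, l. 4563; tree `CMType.above`) (l. 4681; READING R2).
[cite: Liu2021, App. C §C.2 l. 4679–4683 (p. 110)] -/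
def qOf (Φ : CMType E) (Ψ : (E →+* ℂ) →₀ ℕ) (τ : F →+* ℝ) : ℕ :=
  Ψ (CMType.above F E Φ τ)

/-- «an element `Ψ` of `ℕ[Φ_E]` such that `p_τ + q_τ = n` for every `τ ∈ Φ_F`» (l. 4683). [cite: Liu2021, App. C §C.2 l. 4683 (p. 110)] -/
def IsSignatureType (Φ : CMType E) (n : ℕ) (Ψ : (E →+* ℂ) →₀ ℕ) : Prop :=
  ∀ τ : F →+* ℝ, pOf F E Φ Ψ τ + qOf F E Φ Ψ τ = n

/-- **`E_Ψ`**, «the fixed field of the stabilizer of `Ψ` in `Gal(ℂ/ℚ)`» (l. 4683): an intermediate field of `ℂ/ℚ`, on the tree's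
`stabilizer` (Def. C.1's device: for `Ψ = sig_{V,Φ}` this is `HermSpace.reflexField V Φ = E_{V,Φ}` on the nose).
[cite: Liu2021, App. C §C.2 l. 4683 (p. 110)] -/
def typeReflexField (Ψ : (E →+* ℂ) →₀ ℕ) : IntermediateField ℚ ℂ :=
  IntermediateField.fixedField (stabilizer E Ψ)

/-! ## Definition C.10 (l. 4685–4695, p. 110): `(E,Ψ)`-abelian schemes and their polarizations -/

/-- **The Kottwitz polynomial of `e ∈ E` for the type `Ψ`**: «`∏_{τ∈Φ_F} (T − τ^+(e))^{p_τ} (T − τ^−(e))^{q_τ}`» (l. 4690) written as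
`∏_{φ∈Φ_E} (T − φ(e))^{Ψ(φ)} ∈ ℂ[T]` (READING R3). [cite: Liu2021, Def. C.10 (1) (p. 110)] -/
def kottwitzPoly (Ψ : (E →+* ℂ) →₀ ℕ) (e : E) : ℂ[X] :=
  ∏ φ : E →+* ℂ, (X - C (φ e)) ^ (Ψ φ)

/-- The Kottwitz polynomial **as an element of `E_Ψ[T]`** («`∈ 𝒪_S[T]`» for an `E_Ψ`-scheme `S`, l. 4691; READING R3): the polynomial
over `E_Ψ` mapping to `kottwitzPoly Ψ e` under `E_Ψ ⊆ ℂ`, selected by `Classical.epsilon` on exactly that property.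
[cite: Liu2021, Def. C.10 (1) (p. 110)] -/
def kottwitzPolyReflex (Ψ : (E →+* ℂ) →₀ ℕ) (e : E) : (typeReflexField E Ψ)[X] :=
  Classical.epsilon fun P : (typeReflexField E Ψ)[X] =>
    P.map (algebraMap (typeReflexField E Ψ) ℂ) = kottwitzPoly E Ψ e

/-- **[Liu2021, Definition C.10 (1)] — an `(E,Ψ)`-abelian scheme `(A, i)` over the `E_Ψ`-scheme `S`**: «a pair `(A, i)`, where `A`
is an abelian scheme over `S`, and `i : E → End_S(A)_ℚ` is a homomorphism of `ℚ`-algebras such that for every `e ∈ E`, the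
characteristic polynomial of `i(e)` on the locally free sheaf `Lie_S(A)` on `S` is equal to
`∏_{τ∈Φ_F} (T − τ^+(e))^{p_τ} (T − τ^−(e))^{q_τ} ∈ 𝒪_S[T]`» (l. 4688–4691).  `A` is the tree's ★ `AbelianSchemeOver S` (MFK Def. 6.1);
`i` is PRESENTED by its restriction to a `c`-stable order `O ⊆ E` acting by genuine endomorphisms (★ `AbelianSchemeOver.RingAction`;
READING R4); the determinant condition is imposed at every geometric point of the `E_Ψ`-scheme `S` in the tree's cotangent
currency (READING R5).  A data carrier; nothing is asserted by declaring it. [cite: Liu2021, Def. C.10 (1) (p. 110)] -/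
structure EPsiAbelianScheme (Ψ : (E →+* ℂ) →₀ ℕ) (S : SchemeOver (typeReflexField E Ψ)) where
  /-- «`A` is an abelian scheme over `S`» (★ `AbelianSchemeOver`). -/
  A : AbelianSchemeOver S.left
  /-- READING R4: the order `O ⊆ E` on which `i` is presented by genuine endomorphisms. -/
  O : Subring E
  /-- `O` is an order: `O ⊗ ℚ = E` («`i : E → End_S(A)_ℚ`» is `ℚ`-linear; READING R4). -/
  isOrder : ∀ e : E, ∃ N : ℕ, N ≠ 0 ∧ (N : E) * e ∈ O
  /-- `O` is stable under the involution `c` (so that `i(e^c)` of Def. C.10 (2) is presented; READING R4). -/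
  conj_mem : ∀ e : E, e ∈ O → conj F E e ∈ O
  /-- «`i : E → End_S(A)_ℚ` is a homomorphism of `ℚ`-algebras», restricted to `O` (★ `RingAction`; READING R4). -/
  act : AbelianSchemeOver.RingAction O A
  /-- «for every `e`, the characteristic polynomial of `i(e)` on … `Lie_S(A)` … is equal to `∏_τ (T − τ^+(e))^{p_τ}(T − τ^−(e))^{q_τ}
  ∈ 𝒪_S[T]`» — at every geometric point `y : Spec Ω → S` of the `E_Ψ`-scheme `S`: the characteristic polynomial of `i(e)_y` on the
  cotangent space at the origin of the fibre `A_y` is the Kottwitz polynomial pushed to `Ω` along `E_Ψ → Ω` (READINGS R3, R5). -/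
  kottwitz : ∀ (Ω : Type) [Field Ω] [IsAlgClosed Ω] [Algebra (typeReflexField E Ψ) Ω] (y : AlgPoints S Ω) (e : O),
    (haveI := act.isMonHom_i e
     (Literature.AlgebraicGeometry.Motives.AbelianVariety.cotangentMap (A.fibre y.left).toAbelianVariety
        (AbelianSchemeOver.fibreHom (act.i e) y.left)).charpoly) =
      (kottwitzPolyReflex E Ψ (e : E)).map (algebraMap (typeReflexField E Ψ) Ω)

/-- **[Liu2021, Definition C.10 (2)] — a polarization of the `(E,Ψ)`-abelian scheme `(A, i)`**: «a polarization `λ : A → A^∨`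
satisfying `λ ∘ i(e) = i(e^c)^∨ ∘ λ` for every `e ∈ E`» (l. 4693): a dual pair `(Â, 𝒫)` and a polarization `λ` in the tree's sense
(★ `DualPair`, ★ `Polarization`, MFK Def. 6.3), with the printed compatibility in diagrammatic order `i(e) ≫ λ = λ ≫ i(e^c)^∨`
(`i(e^c)^∨` = ★ `DualPair.dualIsogenyOver`), for `e ∈ O`, `e^c ∈ O` (READING R4).  A data carrier; nothing is asserted.
[cite: Liu2021, Def. C.10 (2) (p. 110)] -/
structure EPsiPolarization {Ψ : (E →+* ℂ) →₀ ℕ} {S : SchemeOver (typeReflexField E Ψ)} (X : EPsiAbelianScheme F E Ψ S) where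
  /-- the dual abelian scheme `A^∨` with its Poincaré sheaf (★ `DualPair`). -/
  D : X.A.DualPair
  /-- «a polarization `λ : A → A^∨`» (★ `Polarization`). -/
  pol : X.A.Polarization D
  /-- «`λ ∘ i(e) = i(e^c)^∨ ∘ λ` for every `e`»: for `e, e' ∈ O` with `e' = e^c`, `i(e) ≫ λ = λ ≫ i(e')^∨`. -/
  compat : ∀ e e' : X.O, ((e' : E) = conj F E (e : E)) →
    (haveI := X.act.isMonHom_i e'
     X.act.i e ≫ pol.lam =
       pol.lam ≫ Literature.AlgebraicGeometry.AbelianSchemes.AbelianSchemeOver.DualPair.dualIsogenyOver (X.act.i e') D D)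

/-! ## Definition C.11 (l. 4697–4703, pp. 110–111): rational skew-hermitian spaces, similarity; the group of similitude `H`,
the Hodge map `h_{W,Ψ}` (l. 4713–4737, p. 111) -/

/-- **`E ⊗_ℚ R`** for «a ring `R` containing `ℚ`» (Def. C.11), as Mathlib's `R ⊗[ℚ] E` (an `R`-algebra on the left factor;
READING R1). [cite: Liu2021, Def. C.11 (p. 110)] -/
abbrev ER (R : Type) [CommRing R] [Algebra ℚ R] : Type := R ⊗[ℚ] E

/-- **[Liu2021, Definition C.11] — a rational skew-hermitian space over `E ⊗_ℚ R` of rank `n`**, IN COORDINATES (READING R1: the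
free module is `W = (E ⊗_ℚ R)^{⊕n}`): «a `R`-bilinear skew-symmetric non-degenerate pairing `⟨ , ⟩_W : W × W → R` satisfying
`⟨ex, y⟩_W = ⟨x, e^c y⟩_W` for every `e ∈ E` and `x, y ∈ W`» (l. 4698–4702).  «non-degenerate» = Mathlib `LinearMap.Nondegenerate`
(left- and right-separating).  A data carrier; nothing is asserted. [cite: Liu2021, Def. C.11 (pp. 110–111)] -/
structure RatSkewHermSpace (R : Type) [CommRing R] [Algebra ℚ R] (n : ℕ) where
  /-- «a `R`-bilinear … pairing `⟨ , ⟩_W : W × W → R`» on `W = (E ⊗_ℚ R)^{⊕n}`. -/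
  form : (Fin n → ER E R) →ₗ[R] (Fin n → ER E R) →ₗ[R] R
  /-- «skew-symmetric». -/
  skew : ∀ x y : Fin n → ER E R, form x y = -form y x
  /-- «non-degenerate». -/
  nondeg : form.Nondegenerate
  /-- «`⟨ex, y⟩_W = ⟨x, e^c y⟩_W` for every `e ∈ E`» (`e` acting through `E → E ⊗_ℚ R`, `c = conj F E`). -/
  compat : ∀ (e : E) (x y : Fin n → ER E R),
    form (((1 : R) ⊗ₜ[ℚ] e) • x) y = form x (((1 : R) ⊗ₜ[ℚ] conj F E e) • y)

namespace RatSkewHermSpace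

variable {F E}
variable {R : Type} [CommRing R] [Algebra ℚ R] {n : ℕ}

/-- **«`W` and `W'` … is similar»** (Def. C.11, l. 4702): «there exists an isomorphism `f : W → W'` of `E ⊗_ℚ R`-modules such that there
exists some `ν(f) ∈ R^×` satisfying `⟨f(x), f(y)⟩_{W'} = ν(f)⟨x, y⟩_W` for every `x, y ∈ W`». [cite: Liu2021, Def. C.11 (p. 111)] -/
def IsSimilar (W W' : RatSkewHermSpace F E R n) : Prop :=
  ∃ (f : (Fin n → ER E R) ≃ₗ[ER E R] (Fin n → ER E R)) (ν : Rˣ),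
    ∀ x y : Fin n → ER E R, W'.form (f x) (f y) = (ν : R) * W.form x y

/-- The `R`-basis of `W = (E ⊗_ℚ R)^{⊕n}` made of the `1 ⊗ ε_a` in each coordinate, `ε` Mathlib's chosen `ℚ`-basis of `E`
(bookkeeping for base change; READING R1). [cite: Liu2021, Def. C.11 (p. 110)] -/
def stdBasis (R : Type) [CommRing R] [Algebra ℚ R] (n : ℕ) :
    Module.Basis ((_ : Fin n) × Fin (Module.finrank ℚ E)) R (Fin n → ER E R) :=
  Pi.basis fun _ : Fin n => Algebra.TensorProduct.basis R (Module.finBasis ℚ E)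

/-- The Gram matrix of `⟨ , ⟩_W` in the basis `stdBasis` (bookkeeping for base change). [cite: Liu2021, Def. C.11 (p. 110)] -/
def gramMatrix (W : RatSkewHermSpace F E R n) :
    Matrix ((_ : Fin n) × Fin (Module.finrank ℚ E)) ((_ : Fin n) × Fin (Module.finrank ℚ E)) R :=
  LinearMap.toMatrix₂ (stdBasis R n) (stdBasis R n) W.form

/-- **Base change of the pairing along `φ : R → R'`** — the `R'`-bilinear pairing on `W ⊗_R R' = (E ⊗_ℚ R')^{⊕n}` with Gram matrix
`φ(Gram)` in the standard basis; this is «`W ⊗_E 𝔸_E^∞`» (l. 4707, `φ : ℚ → 𝔸^∞`) and «`W ⊗_ℚ R`» in the definition of `H(R)`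
(l. 4715). [cite: Liu2021, App. C §C.2 l. 4707, 4715 (p. 111)] -/
def baseChangeForm {R' : Type} [CommRing R'] [Algebra ℚ R'] (φ : R →+* R') (W : RatSkewHermSpace F E R n) :
    (Fin n → ER E R') →ₗ[R'] (Fin n → ER E R') →ₗ[R'] R' :=
  Matrix.toLinearMap₂ (stdBasis R' n) (stdBasis R' n) ((gramMatrix W).map φ)

/-- «similar … as a rational skew-hermitian space over `E ⊗_ℚ R'`» ACROSS a base change `φ : R → R'` (l. 4707: «`W ⊗_E 𝔸_E^∞` is
similar to `𝕎^∞`»): an `E ⊗_ℚ R'`-linear automorphism `f` of `(E ⊗_ℚ R')^{⊕n}` and `ν ∈ R'^×` with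
`⟨f x, f y⟩_{W'} = ν · ⟨x, y⟩_{W ⊗_R R'}`. [cite: Liu2021, App. C §C.2 l. 4707 (p. 111)] -/
def IsSimilarAlong {R' : Type} [CommRing R'] [Algebra ℚ R'] (φ : R →+* R') (W : RatSkewHermSpace F E R n)
    (W' : RatSkewHermSpace F E R' n) : Prop :=
  ∃ (f : (Fin n → ER E R') ≃ₗ[ER E R'] (Fin n → ER E R')) (ν : R'ˣ),
    ∀ x y : Fin n → ER E R', W'.form (f x) (f y) = (ν : R') * baseChangeForm φ W x y

/-- **`h` is a similitude of the pairing `B` with multiplier `ν`**: «`⟨hx, hy⟩_W = ν(h)⟨x, y⟩_W`» (l. 4715), for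
`h ∈ GL_{E⊗_ℚR}(W) = GL (Fin n) (E ⊗_ℚ R)` acting by `Matrix.mulVec` (READING R1). [cite: Liu2021, App. C §C.2 l. 4713–4716 (p. 111)] -/
def IsSimilitude (B : (Fin n → ER E R) →ₗ[R] (Fin n → ER E R) →ₗ[R] R) (h : GL (Fin n) (ER E R)) (ν : Rˣ) : Prop :=
  ∀ x y : Fin n → ER E R,
    B ((h : Matrix (Fin n) (Fin n) (ER E R)).mulVec x) ((h : Matrix (Fin n) (Fin n) (ER E R)).mulVec y) = (ν : R) * B x y

/-- **The group of similitude of `W` on `R`-points, `{h ∈ GL_{E⊗_ℚR}(W) | ⟨hx, hy⟩_W = ν(h)⟨x, y⟩_W for some ν(h) ∈ R^×}`** (l. 4715)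
— for `𝕎^∞` over `𝔸_E^∞` this is «`𝐇^∞`, the group of similitude of `𝕎^∞`» on `𝔸^∞`-points (l. 4705); as a SET of elements of
`GL (Fin n) (E ⊗_ℚ R)` (READINGS R1, R8). [cite: Liu2021, App. C §C.2 l. 4705, 4713–4716 (p. 111)] -/
def similitudes (W : RatSkewHermSpace F E R n) : Set (GL (Fin n) (ER E R)) :=
  {h | ∃ ν : Rˣ, IsSimilitude W.form h ν}

/-- **`H(R')`** for `W` over `E` (`R = ℚ`) and «a ring `R'` containing `ℚ`»: «`H(R') = {h ∈ GL_{E⊗_ℚR'}(W ⊗_ℚ R') | ⟨hx, hy⟩_W =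
ν(h)⟨x, y⟩_W for some ν(h) ∈ R'^×}`» (l. 4713–4716) — the similitudes of the base-changed pairing; the functor of points of «its group
of similitude, that is, the reductive group over `ℚ`» (reductivity is a printed attribute, not typed).
[cite: Liu2021, App. C §C.2 l. 4713–4716 (p. 111)] -/
def similitudePoints (W : RatSkewHermSpace F E ℚ n) (R' : Type) [CommRing R'] [Algebra ℚ R'] : Set (GL (Fin n) (ER E R')) :=
  {h | ∃ ν : R'ˣ, IsSimilitude (baseChangeForm (algebraMap ℚ R') W) h ν}

/-- **`⟨x, y⟩^†`** for `W` over `E`: the unique `a ∈ E` with `Tr_{E/ℚ}(e·a) = ⟨e x, y⟩_W` for all `e ∈ E` (READING R7; the device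
of l. 4787), selected by `Classical.epsilon` on that property. [cite: Liu2021, App. C §C.2 l. 4709 (p. 111) and §C.3 l. 4787 (p. 112)] -/
def dagger (W : RatSkewHermSpace F E ℚ n) (x y : Fin n → ER E ℚ) : E :=
  Classical.epsilon fun a : E =>
    ∀ e : E, Algebra.trace ℚ E (e * a) = W.form (((1 : ℚ) ⊗ₜ[ℚ] e) • x) y

/-- `x ∈ W` is **positive at `τ`** for «the hermitian form `⟨ , i·⟩_W` on `W ⊗_{E,τ^−} ℂ`» (l. 4709): `Im τ^−(⟨x, x⟩^†) > 0`
(READING R7; `τ^−` = tree `CMType.above`). [cite: Liu2021, App. C §C.2 l. 4709 (p. 111)] -/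
def IsPosAt (Φ : CMType E) (W : RatSkewHermSpace F E ℚ n) (τ : F →+* ℝ) (x : Fin n → ER E ℚ) : Prop :=
  0 < ((CMType.above F E Φ τ) (W.dagger x x)).im

/-- `x ∈ W` is **negative at `τ`** for `⟨ , i·⟩_W` on `W ⊗_{E,τ^−} ℂ` (l. 4709; READING R7). [cite: Liu2021, App. C §C.2 l. 4709 (p. 111)] -/
def IsNegAt (Φ : CMType E) (W : RatSkewHermSpace F E ℚ n) (τ : F →+* ℝ) (x : Fin n → ER E ℚ) : Prop :=
  ((CMType.above F E Φ τ) (W.dagger x x)).im < 0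

/-- The positive index of `⟨ , i·⟩_W` at `τ`: the largest `E ⊗_ℚ ℚ`-rank of a submodule of `W` on which every non-zero vector is
positive at `τ` (READING R7, the device of `DefC1toC3` `posIndex`). [cite: Liu2021, App. C §C.2 l. 4709 (p. 111)] -/
def posIndexAt (Φ : CMType E) (W : RatSkewHermSpace F E ℚ n) (τ : F →+* ℝ) : ℕ :=
  sSup {k : ℕ | ∃ U : Submodule (ER E ℚ) (Fin n → ER E ℚ),
    Module.finrank (ER E ℚ) U = k ∧ ∀ x ∈ U, x ≠ 0 → W.IsPosAt Φ τ x}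

/-- The negative index of `⟨ , i·⟩_W` at `τ` (READING R7). [cite: Liu2021, App. C §C.2 l. 4709 (p. 111)] -/
def negIndexAt (Φ : CMType E) (W : RatSkewHermSpace F E ℚ n) (τ : F →+* ℝ) : ℕ :=
  sSup {k : ℕ | ∃ U : Submodule (ER E ℚ) (Fin n → ER E ℚ),
    Module.finrank (ER E ℚ) U = k ∧ ∀ x ∈ U, x ≠ 0 → W.IsNegAt Φ τ x}

/-- **«the signature of the hermitian form `⟨ , i·⟩_W` on the `ℂ`-vector space `W ⊗_{E,τ^−} ℂ`»** (l. 4709; READING R7).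
[cite: Liu2021, App. C §C.2 l. 4709 (p. 111)] -/
def sigAt (Φ : CMType E) (W : RatSkewHermSpace F E ℚ n) (τ : F →+* ℝ) : ℕ × ℕ :=
  (W.posIndexAt Φ τ, W.negIndexAt Φ τ)

end RatSkewHermSpace

/-- **`𝔸^∞`**, the finite adèles of `ℚ` (Mathlib), so that «`𝔸_E^∞ = E ⊗_ℚ 𝔸^∞`» (l. 4705) is `ER E Afin`. [cite: Liu2021, App. C §C.2 l. 4705 (p. 111)] -/
abbrev Afin : Type := FiniteAdeleRing (𝓞 ℚ) ℚ

/-- **`W ∈ 𝒲(𝕎^∞, Ψ)`** (membership of the class of `W`, l. 4705–4710): «rational skew-hermitian spaces `W` over `E` of rank `n` such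
that • `W ⊗_E 𝔸_E^∞` is similar to `𝕎^∞` as a rational skew-hermitian space over `𝔸_E^∞ = E ⊗_ℚ 𝔸^∞` …, • the signature of the
hermitian form `⟨ , i·⟩_W` on the `ℂ`-vector space `W ⊗_{E,τ^−} ℂ` is `(p_τ, q_τ)`» (for every `τ ∈ Φ_F`; READINGS R1, R2, R7).  The
parenthetical «(and we fix a similarity isomorphism)» is a choice of witness, not a condition. [cite: Liu2021, App. C §C.2 l. 4705–4710 (p. 111)] -/
def InClassSet {n : ℕ} (𝕎 : RatSkewHermSpace F E Afin n) (Φ : CMType E) (Ψ : (E →+* ℂ) →₀ ℕ)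
    (W : RatSkewHermSpace F E ℚ n) : Prop :=
  RatSkewHermSpace.IsSimilarAlong (algebraMap ℚ Afin) W 𝕎 ∧
    ∀ τ : F →+* ℝ, W.sigAt Φ τ = (pOf F E Φ Ψ τ, qOf F E Φ Ψ τ)

/-- **«It is a finite set»** (l. 4711, of `𝒲(𝕎^∞, Ψ)`): the spaces `W` over `E` in `𝒲(𝕎^∞,Ψ)` fall into finitely many similarity
classes — there is a finite family of them to one of which every such `W` is similar.  CLOSED named fact on REAL data (every
`𝕎^∞`, CM type `Φ`, and `Ψ` with «`p_τ + q_τ = n`» (l. 4683) — the standing data of the sentence). NOT PROVED here. [cite: Liu2021, App. C §C.2 l. 4711 (p. 111)] -/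
def ClassSetFinite : Prop :=
  ∀ (n : ℕ) (𝕎 : RatSkewHermSpace F E Afin n) (Φ : CMType E) (Ψ : (E →+* ℂ) →₀ ℕ), IsSignatureType F E Φ n Ψ →
    ∃ s : Finset (RatSkewHermSpace F E ℚ n),
      ∀ W : RatSkewHermSpace F E ℚ n, InClassSet F E 𝕎 Φ Ψ W → ∃ W₀ ∈ s, W.IsSimilar W₀

/-- **«and its cardinality is at most one if `n` is even»** (l. 4711): for even `n`, any two members of `𝒲(𝕎^∞,Ψ)` are similar.
CLOSED named fact on REAL data (standing data as in `ClassSetFinite`). NOT PROVED here. [cite: Liu2021, App. C §C.2 l. 4711 (p. 111)] -/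
def ClassSetSubsingletonOfEven : Prop :=
  ∀ (n : ℕ), Even n → ∀ (𝕎 : RatSkewHermSpace F E Afin n) (Φ : CMType E) (Ψ : (E →+* ℂ) →₀ ℕ),
    IsSignatureType F E Φ n Ψ →
      ∀ (W W' : RatSkewHermSpace F E ℚ n), InClassSet F E 𝕎 Φ Ψ W → InClassSet F E 𝕎 Φ Ψ W' → W.IsSimilar W'

/-- The matrix `diag(a I_p, b I_q)` on `ℂ^{⊕(p+q)}` (cf. `diagPQ` of `DefC1toC3`). [cite: Liu2021, App. C §C.2 l. 4722–4735 (p. 111)] -/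
def diagPQ₂ (p q : ℕ) (a b : ℂ) : Matrix (Fin (p + q)) (Fin (p + q)) ℂ :=
  Matrix.diagonal (Fin.append (fun _ : Fin p => a) (fun _ : Fin q => b))

/-- **The Hodge map `h_{W,Ψ}` on real points, linear components** (l. 4717–4737): «sending `z ∈ ℂ^×` to
`(diag(\bar z I_{p_{τ_1}}, z I_{q_{τ_1}}), …, diag(\bar z I_{p_{τ_d}}, z I_{q_{τ_d}}); z\bar z) ∈ H_ℝ(ℝ)`, where we identify `H_ℝ(ℝ)` as a
subgroup of `GL_n(ℂ)^d × ℂ^×` via `{τ_1^−, …, τ_d^−}`» — the `τ`-th matrix, in the printed coordinates (that identification is the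
printed one, not constructed here, as `DefC1toC3` R7; `p_τ + q_τ = n` under `IsSignatureType`). [cite: Liu2021, App. C §C.2 l. 4717–4737 (p. 111)] -/
def hodgeMapSim (Φ : CMType E) (Ψ : (E →+* ℂ) →₀ ℕ) (z : ℂˣ) (τ : F →+* ℝ) :
    Matrix (Fin (pOf F E Φ Ψ τ + qOf F E Φ Ψ τ)) (Fin (pOf F E Φ Ψ τ + qOf F E Φ Ψ τ)) ℂ :=
  diagPQ₂ (pOf F E Φ Ψ τ) (qOf F E Φ Ψ τ) (starRingEnd ℂ (z : ℂ)) (z : ℂ)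

/-- **The Hodge map `h_{W,Ψ}`, multiplier component** «`z \bar z`» (l. 4734). [cite: Liu2021, App. C §C.2 l. 4717–4737 (p. 111)] -/
def hodgeMapSimMultiplier (z : ℂˣ) : ℂ :=
  (z : ℂ) * starRingEnd ℂ (z : ℂ)

/-! ## The data of §C.2 and its ⟨CARRIER⟩s: `𝕎^∞`, the levels `L`, the Shimura varieties `Sh(H, h_{W,Ψ})_L`, Kottwitz's level
structures, the moduli presheaves (l. 4705–4771, pp. 111–112) -/

/-- `Sch'_{/R}`-objects: «the subcategory of those [schemes over `R`] that are locally Noetherian» (§1.7, l. 1141; READING R9), as an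
object property of the tree's `SchemeOver R = Over (Spec R)`. [cite: Liu2021, §1.7 l. 1141 (p. 20)] -/
def locallyNoetherian (R : Type) [CommRing R] : ObjectProperty (SchemeOver R) :=
  fun X => IsLocallyNoetherian X.left

/-- **`Sch'_{/R}`**, the full subcategory of locally Noetherian `R`-schemes (§1.7, l. 1141: «If `S = Spec R` is affine, then we simply
replace `S` by `R`»; READING R9). [cite: Liu2021, §1.7 l. 1141 (p. 20)] -/
abbrev SchLN (R : Type) [CommRing R] : Type 1 := (locallyNoetherian R).FullSubcategory

/-- For a subfield `K ⊆ ℂ` and a rational prime `p`, **`O_{K,(p)} = 𝒪_K ⊗_ℤ ℤ_{(p)}`** as a subring of `K` (the base of Rem. C.13 for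
`K = E_Ψ`): the subring generated by the algebraic integers of `K` and the inverses `ℓ⁻¹` of the rational primes `ℓ ≠ p`.
[cite: Liu2021, Rem. C.13 (p. 112)] -/
def integersAt (K : IntermediateField ℚ ℂ) (p : ℕ) : Subring K :=
  Subring.closure ((integralClosure ℤ K : Set K) ∪ {x : K | ∃ ℓ : ℕ, ℓ.Prime ∧ ℓ ≠ p ∧ x = (ℓ : K)⁻¹})

/-- An object of `Sch'_{/K}` regarded in `Sch'_{/O_{K,(p)}}` along `O_{K,(p)} ⊆ K` (the restriction «to `Sch'_{/E_Ψ}`» implicit in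
«admits an extension», Rem. C.13 l. 4762), as a functor (Mathlib `Over.map` along `Spec K → Spec O_{K,(p)}`; the underlying scheme is
unchanged, so local Noetherianity is kept). [cite: Liu2021, Rem. C.13 (p. 112)] -/
def viaIntegers (K : IntermediateField ℚ ℂ) (p : ℕ) : SchLN K ⥤ SchLN (integersAt K p) :=
  ObjectProperty.lift (locallyNoetherian (integersAt K p))
    (ObjectProperty.ι (locallyNoetherian K) ⋙
      Over.map (Spec.map (CommRingCat.ofHom (integersAt K p).subtype)))
    fun S => S.property

/-- «there is an isogeny `φ : A → A'`» of abelian schemes over `S` (Def. C.12, l. 4750), for a homomorphism `φ`: an isogeny on every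
geometric fibre (READING R6; tree `Motives.AbelianVariety.IsIsogeny`, ★ `AbelianSchemeOver.fibreHom`). [cite: Liu2021, Def. C.12 (p. 112)] -/
def IsIsogenyOver {S : Scheme.{0}} {A A' : AbelianSchemeOver S} (φ : A.X ⟶ A'.X) [IsMonHom φ] : Prop :=
  ∀ (Ω : Type) [Field Ω] [IsAlgClosed Ω] (s : Spec (.of Ω) ⟶ S),
    Literature.AlgebraicGeometry.Motives.AbelianVariety.IsIsogeny (AbelianSchemeOver.fibreHom φ s)

/-- ⟨CARRIER⟩ **Kottwitz's level structures** — «`η` is an `L`-level structure (see [Kot92, Section 5] for more details)» (Def. C.12,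
l. 4748) and «taking … `η` to `η'`» (l. 4750): print gives no definition, so the NOTION is posited, for levels in an index type `Λ`: for
every `L`, every `E_Ψ`-scheme `S` and every `(E,Ψ)`-abelian scheme over `S` a type of `L`-level structures, and the relation «the
homomorphism `φ` takes `η` to `η'`».  Nothing is asserted. [cite: Liu2021, Def. C.12 (pp. 111–112)] -/
structure LevelNotion (Ψ : (E →+* ℂ) →₀ ℕ) (Λ : Type) where
  /-- ⟨CARRIER⟩ the `L`-level structures `η` on an `(E,Ψ)`-abelian scheme over `S` ([Kot92, §5]). -/
  Lvl : Λ → ∀ (S : SchemeOver (typeReflexField E Ψ)), EPsiAbelianScheme F E Ψ S → Type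
  /-- ⟨CARRIER⟩ «`φ` tak[es] `η` to `η'`» along a homomorphism `φ : A → A'` over `S`. -/
  Takes : ∀ {L : Λ} {S : SchemeOver (typeReflexField E Ψ)} {X X' : EPsiAbelianScheme F E Ψ S},
    (X.A.X ⟶ X'.A.X) → Lvl L S X → Lvl L S X' → Prop

/-- **A quadruple `(A, i, λ, η)` of Definition C.12 over `S`** for the level `L` (l. 4742–4748): an `(E,Ψ)`-abelian scheme (Def. C.10
(1)), a polarization of it (Def. C.10 (2)), an `L`-level structure (⟨CARRIER⟩ notion `N`). [cite: Liu2021, Def. C.12 (pp. 111–112)] -/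
structure Quadruple {Ψ : (E →+* ℂ) →₀ ℕ} {Λ : Type} (N : LevelNotion F E Ψ Λ) (L : Λ)
    (S : SchemeOver (typeReflexField E Ψ)) where
  /-- «`(A, i)` is an `(E,Ψ)`-abelian scheme over `S` (Definition C.10)». -/
  X : EPsiAbelianScheme F E Ψ S
  /-- «`λ` is a polarization of `(A, i)` (Definition C.10)». -/
  P : EPsiPolarization F E X
  /-- «`η` is an `L`-level structure» (⟨CARRIER⟩). -/
  lvl : N.Lvl L S X

/-- **The equivalence of Definition C.12** (l. 4750): «Two quadruples `(A, i, λ, η)` and `(A', i', λ', η')` are equivalent if there is an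
isogeny `φ : A → A'` taking `i, λ, η` to `i', cλ', η'` for some `c ∈ ℚ^×`» — `φ` a homomorphism and an isogeny (READING R6),
intertwining `i` and `i'` (on `O ∩ O'`, READING R4), with `φ^∨ ∘ λ' ∘ φ = c·λ`, `c = a/b ∈ ℚ^×` (READING R6: `(φ ≫ λ' ≫ φ^∨)^b = λ^a` in
the group `Hom_S(A, Â)`), and taking `η` to `η'` (⟨CARRIER⟩ `N.Takes`). [cite: Liu2021, Def. C.12 (p. 112)] -/
def Quadruple.Equiv {Ψ : (E →+* ℂ) →₀ ℕ} {Λ : Type} {N : LevelNotion F E Ψ Λ} {L : Λ}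
    {S : SchemeOver (typeReflexField E Ψ)} (Q Q' : Quadruple F E N L S) : Prop :=
  ∃ (φ : Q.X.A.X ⟶ Q'.X.A.X) (hφ : IsMonHom φ),
    (haveI : IsMonHom φ := hφ
     IsIsogenyOver φ ∧
     (∀ (e : Q.X.O) (e' : Q'.X.O), (e : E) = (e' : E) → Q.X.act.i e ≫ φ = φ ≫ Q'.X.act.i e') ∧
     (∃ a b : ℤ, a ≠ 0 ∧ b ≠ 0 ∧
       (φ ≫ Q'.P.pol.lam ≫
           Literature.AlgebraicGeometry.AbelianSchemes.AbelianSchemeOver.DualPair.dualIsogenyOver φ Q.P.D Q'.P.D) ^ b =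
         Q.P.pol.lam ^ a) ∧
     N.Takes φ Q.lvl Q'.lvl)

/-- **`M(𝕎^∞, Ψ)_L(S)` ON OBJECTS** (Def. C.12, l. 4742): «the set of equivalence classes of quadruples `(A, i, λ, η)`» over the
`E_Ψ`-scheme `S` — the quotient of `Quadruple N L S` by the printed relation (Lean `Quot`; the level notion `N` is the ⟨CARRIER⟩; the
pull-back maps of the presheaf are the ⟨CARRIER⟩ `SecC2Data.pull`). [cite: Liu2021, Def. C.12 (pp. 111–112)] -/
def PointSet {Ψ : (E →+* ℂ) →₀ ℕ} {Λ : Type} (N : LevelNotion F E Ψ Λ) (L : Λ)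
    (S : SchemeOver (typeReflexField E Ψ)) : Type 1 :=
  Quot (Quadruple.Equiv F E (N := N) (L := L) (S := S))

/-- **The data of §C.2 with its ⟨CARRIER⟩s**, in paper order, over the number fields `F ⊆ E` (l. 4550) and the CM type `Φ` (l. 4558):
REAL `n`, `Ψ` with «`p_τ + q_τ = n`» (l. 4683) and «`𝕎^∞` over `𝔸_E^∞ = E ⊗_ℚ 𝔸^∞` of rank `n`» (l. 4705); ⟨CARRIER⟩ `IsLevel` = «neat
open compact subgroups `L` of `𝐇^∞(𝔸^∞)`», a predicate on subgroups of `GL (Fin n) (E ⊗_ℚ 𝔸^∞)` whose meaning includes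
`L ⊆ 𝐇^∞(𝔸^∞) = RatSkewHermSpace.similitudes 𝕎` (READING R8); ⟨CARRIER⟩ `Sh W L` (+ `tr`) = «the projective system of schemes
`{Sh(H, h_{W,Ψ})_L}_L` … over `E_Ψ` … indexed by neat open compact subgroups `L` of `𝐇^∞(𝔸^∞) ≃ H(𝔸^∞)`» (l. 4737; canonical models
do not exist in Mathlib ∕ the tree; meaningful for `W ∈ 𝒲(𝕎^∞,Ψ)` and admissible `L`, total as a function, as `PropC5Data.Sh`);
⟨CARRIER⟩ `N` = Kottwitz's level notion (l. 4748); ⟨CARRIER⟩ `pull` = the pull-back maps of the presheaf `M(𝕎^∞,Ψ)_L` on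
`Sch'_{/E_Ψ}` (Def. C.12; its values on objects are REAL: `PointSet`), ⟨CARRIER⟩ `res` = its maps `M_{L'} → M_L` for `L' ≤ L`
(«functorial in `L`», l. 4757); for Rem. C.13: ⟨CARRIER⟩ `IsGoodAt p L` = «we may write `L = L^p × L_p` in which `L_p` is the stabilizer
of a self-dual lattice in `𝕎^∞ ⊗_{𝔸^∞} ℚ_p`» (l. 4762), ⟨CARRIER⟩ `Mint p L` = the presheaf `𝓜(𝕎^∞,Ψ)_L` on `Sch'_{/O_{E_Ψ,(p)}}` of
quadruples `(A, i, λ, η^p)` («`(A, i)` … in the sense similar to Definition C.10 but with `i : O_{E,(p)} → End_S(A) ⊗_ℤ ℤ_{(p)}` being a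
homomorphism of `ℤ_{(p)}`-algebras, `λ` … a `p`-principal polarization …, `η^p` … an `L^p`-level structure», equivalence by «isogenies
… coprime to `p` and `c ∈ ℤ_{(p)}^×`» — READING R5: its values are NOT REAL-typed, the determinant condition over a base of mixed
characteristic being a sheaf identity the geometric-point currency does not capture), ⟨CARRIER⟩ `ext p L` = «admits an extension»
(on `Sch'_{/E_Ψ}`-objects `𝓜_L` is `M_L`, compatibly with pull-backs) and ⟨CARRIER⟩ `resInt` = «functorial in `L`» (l. 4770).
Nothing is asserted by this structure. [cite: Liu2021, App. C §C.2 l. 4679–4771 (pp. 110–112)] -/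
structure SecC2Data (Φ : CMType E) where
  /-- «of rank `n`» (l. 4683, 4698, 4705). -/
  n : ℕ
  /-- «`Ψ = Σ p_τ τ^+ + Σ q_τ τ^−` … an element of `ℕ[Φ_E]`» (l. 4681). -/
  Ψ : (E →+* ℂ) →₀ ℕ
  /-- «such that `p_τ + q_τ = n` for every `τ ∈ Φ_F`» (l. 4683). -/
  isSignatureType : IsSignatureType F E Φ n Ψ
  /-- REAL «a rational skew-hermitian space `𝕎^∞` over `𝔸_E^∞ = E ⊗_ℚ 𝔸^∞` of rank `n`» (l. 4705). -/
  𝕎 : RatSkewHermSpace F E Afin n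
  /-- ⟨CARRIER⟩ «neat open compact subgroups `L` of `𝐇^∞(𝔸^∞)`» (l. 4737, 4742; READING R8). -/
  IsLevel : Subgroup (GL (Fin n) (ER E Afin)) → Prop
  /-- ⟨CARRIER⟩ `Sh W L = Sh(H, h_{W,Ψ})_L`, a scheme over `E_Ψ` (l. 4737). -/
  Sh : RatSkewHermSpace F E ℚ n → Subgroup (GL (Fin n) (ER E Afin)) → SchemeOver (typeReflexField E Ψ)
  /-- ⟨CARRIER⟩ the transition maps of «the projective system … `{Sh(H, h_{W,Ψ})_L}_L`», `L' ≤ L ↦ (Sh_{L'} → Sh_L)`. -/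
  tr : ∀ (W : RatSkewHermSpace F E ℚ n) {L L' : Subgroup (GL (Fin n) (ER E Afin))}, L' ≤ L → (Sh W L' ⟶ Sh W L)
  /-- projective system: identity. -/
  tr_refl : ∀ W (L : Subgroup (GL (Fin n) (ER E Afin))), tr W (le_refl L) = 𝟙 (Sh W L)
  /-- projective system: composition. -/
  tr_trans : ∀ W {L L' L'' : Subgroup (GL (Fin n) (ER E Afin))} (h' : L'' ≤ L') (h : L' ≤ L),
    tr W (h'.trans h) = tr W h' ≫ tr W h
  /-- ⟨CARRIER⟩ Kottwitz's notion of `L`-level structure ([Kot92, §5], l. 4748). -/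
  N : LevelNotion F E Ψ (Subgroup (GL (Fin n) (ER E Afin)))
  /-- ⟨CARRIER⟩ the pull-back maps of the presheaf `M(𝕎^∞,Ψ)_L` on `Sch'_{/E_Ψ}` (Def. C.12): for `g : T → S`, `M_L(S) → M_L(T)`. -/
  pull : ∀ (L : Subgroup (GL (Fin n) (ER E Afin))) {S T : SchLN (typeReflexField E Ψ)}, (T ⟶ S) →
    PointSet F E N L S.obj → PointSet F E N L T.obj
  /-- presheaf: identity. -/
  pull_id : ∀ L (S : SchLN (typeReflexField E Ψ)), pull L (𝟙 S) = id
  /-- presheaf: composition. -/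
  pull_comp : ∀ L {S T U : SchLN (typeReflexField E Ψ)} (g : T ⟶ S) (h : U ⟶ T), pull L (h ≫ g) = pull L h ∘ pull L g
  /-- ⟨CARRIER⟩ «functorial in `L`» (l. 4757): for `L' ≤ L` the maps `M_{L'}(S) → M_L(S)`. -/
  res : ∀ {L L' : Subgroup (GL (Fin n) (ER E Afin))}, L' ≤ L → ∀ S : SchLN (typeReflexField E Ψ),
    PointSet F E N L' S.obj → PointSet F E N L S.obj
  /-- ⟨CARRIER⟩ Rem. C.13's hypothesis on `(p, L)`: «we may write `L = L^p × L_p` in which `L_p` is the stabilizer of a self-dual lattice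
  in `𝕎^∞ ⊗_{𝔸^∞} ℚ_p`» (l. 4762). -/
  IsGoodAt : ℕ → Subgroup (GL (Fin n) (ER E Afin)) → Prop
  /-- ⟨CARRIER⟩ `𝓜(𝕎^∞,Ψ)_L`, the presheaf on `Sch'_{/O_{E_Ψ,(p)}}` of Rem. C.13 (READINGS R5, R9). -/
  Mint : ∀ (p : ℕ) (_ : Subgroup (GL (Fin n) (ER E Afin))),
    (SchLN (integersAt (typeReflexField E Ψ) p))ᵒᵖ ⥤ Type 1
  /-- ⟨CARRIER⟩ «admits an extension `𝓜(𝕎^∞,Ψ)_L`» of `M(𝕎^∞,Ψ)_L` (l. 4762): on `Sch'_{/E_Ψ}`-objects the values agree … -/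
  ext : ∀ (p : ℕ) (L : Subgroup (GL (Fin n) (ER E Afin))) (S : SchLN (typeReflexField E Ψ)),
    (Mint p L).obj (Opposite.op ((viaIntegers (typeReflexField E Ψ) p).obj S)) ≃ PointSet F E N L S.obj
  /-- … compatibly with pull-backs. -/
  ext_naturality : ∀ (p : ℕ) (L : Subgroup (GL (Fin n) (ER E Afin))) {S T : SchLN (typeReflexField E Ψ)} (g : T ⟶ S)
    (x : (Mint p L).obj (Opposite.op ((viaIntegers (typeReflexField E Ψ) p).obj S))),
    ext p L T ((Mint p L).map ((viaIntegers (typeReflexField E Ψ) p).map g).op x) = pull L g (ext p L S x)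
  /-- ⟨CARRIER⟩ «and is functorial in `L`» (Rem. C.13, l. 4770): for `L' ≤ L` the maps `𝓜_{L'} → 𝓜_L`. -/
  resInt : ∀ (p : ℕ) {L L' : Subgroup (GL (Fin n) (ER E Afin))}, L' ≤ L → (Mint p L' ⟶ Mint p L)

namespace SecC2Data

variable {F E} {Φ : CMType E} (D : SecC2Data F E Φ)

/-- «`L` sufficiently small» (l. 4753, 4770; READING R8): the admissible levels below an admissible threshold `L₀`.
[cite: Liu2021, App. C §C.2 l. 4753 (p. 112)] -/
def SmallLevels (L₀ : Subgroup (GL (Fin D.n) (ER E Afin))) : Set (Subgroup (GL (Fin D.n) (ER E Afin))) :=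
  {L | D.IsLevel L ∧ L ≤ L₀}

/-! ## The printed claims of §C.2 as predicates on the datum (NOT asserted) -/

/-- **(l. 4737, p. 111 L56–61) «Then we have a Shimura data `(H, h_{W,Ψ})` with the reflex field `E_Ψ`. We obtain a projective system of
schemes `{Sh(H, h_{W,Ψ})_L}_L`, quasi-projective and smooth over `E_Ψ` of dimension `Σ_{τ∈Φ_F} p_τ q_τ`, indexed by neat open compact
subgroups `L` of `𝐇^∞(𝔸^∞) ≃ H(𝔸^∞)`»** — for every `W ∈ 𝒲(𝕎^∞,Ψ)` and every admissible `L`, the carrier `Sh W L` (already typed over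
`E_Ψ`) is quasi-projective (tree `IsQuasiProjectiveOver`) and smooth of relative dimension `Σ_τ p_τ q_τ` over `E_Ψ`.  «Shimura data», «of
PEL type» (l. 4739) are recorded, not typed. [cite: Liu2021, App. C §C.2 l. 4737 (p. 111)] -/
def ShimuraVarietiesAsPrinted : Prop :=
  ∀ (W : RatSkewHermSpace F E ℚ D.n), InClassSet F E D.𝕎 Φ D.Ψ W →
    ∀ L, D.IsLevel L →
      IsQuasiProjectiveOver (D.Sh W L) ∧
        SmoothOfRelativeDimension (∑ τ : F →+* ℝ, pOf F E Φ D.Ψ τ * qOf F E Φ D.Ψ τ) (D.Sh W L).hom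

/-- **(l. 4753–4757, p. 112 L10–19) «From [Kot92], it is known that `M(𝕎^∞, Ψ)_L` is a scheme if `L` is sufficiently small, and we have a
canonical isomorphism `M(𝕎^∞, Ψ)_L ≃ ∐_{W ∈ 𝒲(𝕎^∞,Ψ)} Sh(H, h_{W,Ψ})_L` functorial in `L`.»**  TYPED: there are an admissible threshold
`L₀` and a finite transversal `W : ι → …` of `𝒲(𝕎^∞,Ψ)` (its classes: cf. `ClassSetFinite`) such that for every admissible `L ≤ L₀` the
presheaf `M_L` (REAL on objects: `PointSet`; ⟨CARRIER⟩ pull-backs) is represented by an `E_Ψ`-scheme `X_L` — natural bijections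
`M_L(S) ≃ Hom_{E_Ψ}(S, X_L)` on `Sch'_{/E_Ψ}` — which is the coproduct of the `Sh(H, h_{W_i,Ψ})_L` (open immersions `c_i` with pairwise
disjoint images covering `X_L`), and for `L' ≤ L` there are morphisms `u : X_{L'} → X_L` compatible with the transition maps of the `Sh`
and with `res` («functorial in `L`»). [cite: Liu2021, App. C §C.2 l. 4753–4757 (p. 112)] -/
def ModuliIsSchemeAndDecomposes : Prop :=
  ∃ (L₀ : Subgroup (GL (Fin D.n) (ER E Afin))) (_ : D.IsLevel L₀)
    (J : Type) (_ : Fintype J) (W : J → RatSkewHermSpace F E ℚ D.n)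
    -- `W` is a transversal of the similarity classes in `𝒲(𝕎^∞,Ψ)`
    (_ : ∀ i, InClassSet F E D.𝕎 Φ D.Ψ (W i))
    (_ : ∀ i j, (W i).IsSimilar (W j) → i = j)
    (_ : ∀ W', InClassSet F E D.𝕎 Φ D.Ψ W' → ∃ i, W'.IsSimilar (W i))
    -- the representing schemes `X_L` with their universal bijections `e_L` and coproduct injections `c_L i`
    (X : Subgroup (GL (Fin D.n) (ER E Afin)) → SchemeOver (typeReflexField E D.Ψ))
    (e : ∀ L (S : SchLN (typeReflexField E D.Ψ)), PointSet F E D.N L S.obj ≃ (S.obj ⟶ X L))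
    (c : ∀ L i, D.Sh (W i) L ⟶ X L)
    (u : ∀ {L L' : Subgroup (GL (Fin D.n) (ER E Afin))}, L' ≤ L → (X L' ⟶ X L)),
    ∀ L ∈ D.SmallLevels L₀,
      -- «`M(𝕎^∞,Ψ)_L` is a scheme»: `e_L` is natural in `S ∈ Sch'_{/E_Ψ}`
      (∀ {S T : SchLN (typeReflexField E D.Ψ)} (g : T ⟶ S) (x : PointSet F E D.N L S.obj),
          e L T (D.pull L g x) = g.hom ≫ e L S x) ∧
      -- «`≃ ∐_{W ∈ 𝒲(𝕎^∞,Ψ)} Sh(H, h_{W,Ψ})_L`»: `X_L` is the disjoint union of the images of the open immersions `c_L i`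
      (∀ i, IsOpenImmersion (c L i).left) ∧
      (∀ i j, i ≠ j → Disjoint (Set.range fun x => (c L i).left.base x) (Set.range fun x => (c L j).left.base x)) ∧
      (⋃ i, Set.range (fun x => (c L i).left.base x)) = Set.univ ∧
      -- «functorial in `L`»
      (∀ L' ∈ D.SmallLevels L₀, ∀ (h : L' ≤ L),
          (∀ i, c L' i ≫ u h = D.tr (W i) h ≫ c L i) ∧
          ∀ (S : SchLN (typeReflexField E D.Ψ)) (x : PointSet F E D.N L' S.obj), e L S (D.res h S x) = e L' S x ≫ u h)

/-- **[Liu2021, Remark C.13]** (l. 4761–4771, p. 112 L20–34): «Let `p` be a rational prime unramified in `E` such that we may write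
`L = L^p × L_p` in which `L_p` is the stabilizer of a self-dual lattice in `𝕎^∞ ⊗_{𝔸^∞} ℚ_p`. Then the presheaf `M(𝕎^∞, Ψ)_L` admits an
extension `𝓜(𝕎^∞, Ψ)_L` to a presheaf on `Sch'_{/O_{E_Ψ,(p)}}` [… quadruples `(A, i, λ, η^p)` …]. The functor `𝓜(𝕎^∞, Ψ)_L` is a smooth
separated scheme in `Sch_{/O_{E_Ψ,(p)}}` if `L` is sufficiently small; and is functorial in `L`.»  TYPED (REAL: `p` prime, «unramified in
`E`» = `p ∤ disc E`, the base `O_{E_Ψ,(p)}` = `integersAt`, «smooth separated scheme» = Mathlib `Smooth` ∕ `IsSeparated` of the structure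
morphism, representability = natural bijections on `Sch'_{/O_{E_Ψ,(p)}}`; ⟨CARRIER⟩: `IsGoodAt`, the presheaf `Mint` with `ext`, READING
R5 ∕ R8): for every such `p` there is an admissible threshold `L₀` such that for every admissible good `L ≤ L₀`, `𝓜_L` is represented by
a smooth separated `O_{E_Ψ,(p)}`-scheme. [cite: Liu2021, Rem. C.13 (p. 112)] -/
def RemC13 : Prop :=
  ∀ p : ℕ, p.Prime → ¬ ((p : ℤ) ∣ NumberField.discr E) →
    ∃ (L₀ : Subgroup (GL (Fin D.n) (ER E Afin))), D.IsLevel L₀ ∧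
      ∀ L ∈ D.SmallLevels L₀, D.IsGoodAt p L →
        ∃ (X : SchemeOver (integersAt (typeReflexField E D.Ψ) p))
          (e : ∀ T : SchLN (integersAt (typeReflexField E D.Ψ) p), (D.Mint p L).obj (Opposite.op T) ≃ (T.obj ⟶ X)),
          Smooth X.hom ∧ IsSeparated X.hom ∧
            ∀ {T T' : SchLN (integersAt (typeReflexField E D.Ψ) p)} (g : T' ⟶ T) (x : (D.Mint p L).obj (Opposite.op T)),
              e T' ((D.Mint p L).map g.op x) = g.hom ≫ e T x

end SecC2Data

/-! ## §C.1 residue (deal TL-plan 01:55:56Z): Remark C.9 on the ★ `CompactifiedSystem` of `Glue.lean` -/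

/-- **[Liu2021, Remark C.9]** (l. 4667–4669, p. 110 L25–26): «The boundary `S̃h(𝕍)_K ∖ Sh(𝕍)_K` is a smooth divisor.» — for the
compactified Shimura varieties `X_K = S̃h(𝕍)_K` of a system `S` of Shimura varieties associated to `𝕍` (★ `Glue.lean`
`IncoherentShimuraSystem`, `CompactifiedSystem`: `C.j.app K : Sh(𝕍)_K ↪ X_K` the open immersion): for every sufficiently small `K` there is
a closed subscheme `B ↪ X_K` over `E` whose underlying set is the complement of (the image of) `Sh(𝕍)_K` and which is smooth over `E` of
relative dimension `n − 2` (READING: «smooth divisor» on the smooth `(n−1)`-dimensional `X_K` = smooth closed subscheme of codimension one,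
which on a smooth scheme is an effective Cartier divisor).  A predicate; NOT asserted. [cite: Liu2021, Rem. C.9 (p. 110)] -/
def RemC9 {D : PropC5Data F E} {S : IncoherentShimuraSystem D} (C : CompactifiedSystem S) : Prop :=
  ∀ K : C5.SmallLevel S.K₀, ∃ (B : SchemeOver E) (emb : B ⟶ C.X.obj K),
    IsClosedImmersion emb.left ∧
      Set.range (fun x => emb.left.base x) = (Set.range fun x => (C.j.app K).left.base x)ᶜ ∧
        SmoothOfRelativeDimension (D.n - 2) B.hom

end Literature.NumberTheory.Automorphic.Liu2021.AppendixC.SecC2Similitude
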